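import Summits.BirchSwinnertonDyer.Rank1Residual.X11b.RegMultCertificateJoin
import Summits.BirchSwinnertonDyer.Rank1Residual.X11b.CensusPAdicLeadingTermBridge
import HarnessLib

/-!
# REG-MULT certificates at a SPLIT multiplicative `3` ⟶ the kernel: the JOIN on x11b3's residue
# `SplitThreeResidueAt` (census cell `bsd-formula-census`, seat conjecture-typer 2, CELL-PLAN §3 H-7;
# register `cells/x11b3/PREDICTIONS-REG3B.md` §5 / §8 (vii), census-lead G-14 = PASS register-only)

HONEST FRAMING (run/shared/lean/b2b/bsd-rank1-residual/, verbatim in every file): the goal of the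
cell is to DELETE the COMBINATION-SHAPED residual classes of the Birch–Swinnerton-Dyer formula for
ALL analytic-rank `≤ 1` elliptic curves over `ℚ` — "full BSD formula for every rank `≤ 1` curve in
class `C`" assembled STRICTLY from published theorems — so that the rank-`≤ 1` remainder becomes
exactly the CONSTRUCTION-SHAPED classes, which are TYPED (missing-input `Prop`s), NOT attempted.
This is not "finishing BSD". Research route; no claim beyond the stated classes; census / instrument
output = EVIDENCE / certificate rows (instrumentation tier; what a certified row is worth is referee
A's / the director's ruling), never a Literature fact; the class-wide statement — Schneider's
non-degeneracy conjecture — is NEVER asserted (barrier file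
`Literature/Barriers/BirchSwinnertonDyer/PAdicHeightNondegeneracy`); `X11 ∧ r = 1 ∧ p = 3` stays
CONSTRUCTION-SHAPED, §I O2 OPEN; nothing below is booked; no label, count or RESIDUAL-MAP mark moves.

## What this file adds to `X11b/RegMultCertificateJoin.lean` (p251709)

p251709 joined ONE REGMULT-PAIR/v1 row to the consumers on the LEVER LOCUS (non-split (ram) at every
odd `p`; split (ram) at `p ≥ 5`). The 961 TRUE-OPEN X11b classes SPLIT at `3` with a (ram) prime —
x11b3's residue `ClassClosure.SplitThreeResidueAt W` (cc-typer-3, `X11b/ClassClosureTyped.lean`) — are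
NOT on the locus: there Disegni's Thm. 1 carries "`p ≥ 5`" in its hypothesis (∗), and the node of
record is the EVIDENCE-labelled conjecture `ClassClosure.RelativeExceptionalLeadingTermAt W 3`
(x11b3-lead R7-23: the (R4) residual of road (b)-cyc = per-pair `Reg₃ ≠ 0`; the leading-term node
stays a NAMED INPUT). cc-typer-3's residue consumer `ClassClosure.bsdp_three_of_splitThreeResidue_of_
conjecture` takes the BUNDLED per-pair input `ClassClosure.RegulatorNonvanishingAt W 3` — BOTH halves,
although only the split half `.2` is used — and a split certificate `RegMult.CertSplit W 3 P m`
supplies only `.2` (`RegMult.schneiderHalf_split_of_cert`; the `.1` half quantifies over (4.1)-data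
that no certificate on a split curve addresses). This file closes that seam, SIGN-AWARE:

1. `ClassClosure.bsdp_three_of_splitThreeResidue_of_conjecture_of_schneiderSplit` — cc-typer-3's
   residue consumer with the split half ALONE as the regulator input (same published facts: Skinner
   2016 Thm. A `hA`, Stein–Wuthrich 2013 Thm. 6.1 split `hJs` + §4.2 height existence `hHs`, GZK,
   modularity; + the conjecture `hC`).
2. `RegMult.Three.bsdp_of_classX11b_of_split_of_ram_of_cert_of_relativeExceptional` — **the REG3B
   consumer of record TODAY**: on `ClassX11b W 3 ∧ split ∧ (ram)`, `BSD(E,3)` from the published facts,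
   ONE REGMULT row `RegMult.CertSplit W 3 P m` (the certificate) AND the conjecture
   `RelativeExceptionalLeadingTermAt W 3` (the NAMED INPUT) — TWO per-pair inputs, exactly as the
   register's §5 says; the row BOOKS NOTHING on its own.
3. `RegMult.Three.bsdp_of_classX11b_of_ram_of_cert_of_conjectureIfSplit` — the whole (ram) atom of
   N8/O2 at `3` (= all 1 684 TRUE-OPEN X11b classes at `3`: 722 + 1 non-split, 961 split) in ONE
   statement with the certificate OF THE ROW'S SIGN in place of the bundled input (cc-typer-3's
   `bsdp_of_ram_of_regulatorNonvanishing_of_conjectureAtThree`, certificate currency): "ONE verdict per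
   (isogeny class, 3)" of the REGMULT fold, kernel side.
4. `RegMult.order_eq_two_of_relativeExceptional_of_cert` — converse bookkeeping in certificate
   currency (any odd `p`): the conjecture + ONE split row + Greenberg–Stevens ⇒ the ORDER clause
   `ord_{T=0} L_p(E,T) = 2` of the census relation X11b-1 (`CensusLeadingTermSplit`, clause (i)); the
   identity clause comes back only up to the unit `u` (p250497 §5).

Instances (EVIDENCE, never facts; rows of record = the census files): the W5 REG-MULT production
tranche at `p = 3` (ttrl `bsd-formula-census/regmult/prod/`, 960 ok + 1 budget split rows, two engines
PARI `ellpadicregulator` / SW13 §4.2 θ-product, summary level 2026-08-21T07:59Z; per-row fold pending)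
= E1/E2 of the register `cells/x11b3/PREDICTIONS-REG3B.md` (x11b3-p6; census-lead G-14 PASS,
REGISTER-ONLY, requests l.1590; A1 anti-duplication: one verdict per (class, 3), a third engine = E3,
no double count). Nothing here computes a height or asserts a certificate.
[cite: SteinWuthrich2013, §4.2 (p. 16), Thm. 6.1] [cite: Skinner2016PacificMC, Thm. A]
[cite: Disegni2020, Thm. 1 (§1.2), hypothesis (∗)] [cite: MazurTateTeitelbaum1986Invent, §II.10]
-/

open scoped Classical MatrixGroups ModularForm

open CongruenceSubgroup WeierstrassCurve Literature.NumberTheory.EllipticCurves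
  Literature.NumberTheory.EllipticCurves.ModularForms
  Literature.NumberTheory.EllipticCurves.Rank1Residual
  Literature.NumberTheory.EllipticCurves.Rank1Residual.Typed
  Literature.NumberTheory.EllipticCurves.Skinner2016
  Literature.NumberTheory.EllipticCurves.SteinWuthrich2013
  Literature.NumberTheory.EllipticCurves.Disegni2020

namespace Summit.BirchSwinnertonDyer.Rank1Residual.X11b

/-! ### §1 The residue consumer, sign-aware (split half only) -/

namespace ClassClosure

variable (W : WeierstrassCurve ℚ) [W.IsElliptic] [W.IsGloballyMinimal]

/-- **x11b3's residue `SplitThreeResidueAt` (split at `3`, (ram)): `BSD(E,3)` from the PUBLISHED facts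
(Skinner 2016 Thm. A `hA` — main-conjecture equality on (irr)+(ram) at `p ≥ 3`; Stein–Wuthrich 2013
Thm. 6.1 split clause `hJs` and §4.2 height existence `hHs`; GZK `hGZK`; modularity `hpar`), the
EVIDENCE-labelled CONJECTURE `RelativeExceptionalLeadingTermAt W 3` (`hC`), and — as the ONLY regulator
input — Schneider's non-degeneracy for THE modified §4.2 datum (`hSch`, the SPLIT half of cc-typer-3's
bundled `RegulatorNonvanishingAt W 3`; its (4.1)-half is not needed on a split curve).** Same proof as
`bsdp_three_of_splitThreeResidue_of_conjecture` (cc-typer-3), whose last step used only `hReg.2`.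
CONDITIONAL on an unproved conjecture and the named facts; nothing booked; O2 OPEN.
[cite: Skinner2016PacificMC, Thm. A] [cite: SteinWuthrich2013, Thm. 6.1, §4.2 (p. 16)]
[cite: Miller2011LMS, Def. 1.1] -/
theorem bsdp_three_of_splitThreeResidue_of_conjecture_of_schneiderSplit [Fact (Nat.Prime 3)]
    (hA : thmA_charIdeal_multiplicative) (hJs : thm61_splitMultiplicative)
    (hHs : exists_isSplitMultCanonical)
    (hGZK : rank_eq_analyticRank_of_analyticRank_le_one) (hpar : nonempty_modularParametrizationData)
    (hX : ClassX11b W 3) (hres : SplitThreeResidueAt W) (hC : RelativeExceptionalLeadingTermAt W 3)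
    (hSch : ∀ (Dq : TateParameterData W 3) (Dh : PAdicHeightData W 3),
      IsSplitMultCanonical Dh Dq → SchneiderConjecture Dh) : BSDp W 3 := by
  obtain ⟨hr, hp2, hmult, hirr⟩ := hX
  obtain ⟨hsplit, hram⟩ := hres
  obtain ⟨κ, hκ, γ, hγ, hγ'⟩ := exists_isCyclotomic_isTopGenerator_isCyclotomicVariable_holds 3
  obtain ⟨D⟩ := W.nonempty_selmerDualData_holds κ γ hγ
  haveI : NeZero (W.conductorNorm ℤ) := ⟨(W.conductorNorm_pos_holds).ne'⟩
  obtain ⟨Dm⟩ := hpar W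
  obtain ⟨ϖ, hϖpos, hϖ, -⟩ := Dm.exists_rat_mul_realPeriodRat_eq_plusPeriod
  obtain ⟨L, hL⟩ := exists_isSplitMultPAdicLFunctionOf hsplit Dm.isNewformOf
  obtain ⟨Dq⟩ := (nonempty_tateParameterData_iff_holds (W := W) (p := 3)).mpr hsplit
  obtain ⟨Dh, hDh⟩ := hHs W 3 hp2 Dq
  obtain ⟨hXt, g, hchar, hsp, -⟩ := hA W 3 le_rfl hmult hirr hram hκ hγ hγ' Dm.isNewformOf D ϖ
    hϖpos.ne' hϖ
  obtain ⟨w, hw⟩ := hsp hsplit L hL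
  obtain ⟨s, u', hs, hDis⟩ := hC hp2 hsplit hr Dm.isNewformOf ϖ hϖpos.ne' hϖ Dq L hL Dh hDh
  exact bsdp_of_split_of_relativeLeadingTerm_of_schneider W 3 hJs hGZK hp2 hr Dq hκ hγ hγ' D hXt hchar
    w hw Dh hDh hs u' hDis (hSch Dq Dh hDh)

/-- cc-typer-3's bundled-input consumer is the special case `hSch := hReg.2` (bookkeeping: the two
statements agree on what they use). [folklore] -/
theorem bsdp_three_of_splitThreeResidue_of_conjecture_eq_of_schneiderSplit [Fact (Nat.Prime 3)]
    (hA : thmA_charIdeal_multiplicative) (hJs : thm61_splitMultiplicative)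
    (hHs : exists_isSplitMultCanonical)
    (hGZK : rank_eq_analyticRank_of_analyticRank_le_one) (hpar : nonempty_modularParametrizationData)
    (hX : ClassX11b W 3) (hres : SplitThreeResidueAt W) (hC : RelativeExceptionalLeadingTermAt W 3)
    (hReg : RegulatorNonvanishingAt W 3) : BSDp W 3 :=
  bsdp_three_of_splitThreeResidue_of_conjecture_of_schneiderSplit W hA hJs hHs hGZK hpar hX hres hC hReg.2

end ClassClosure

/-! ### §2 The REG3B consumer of record: ONE split certificate + the conjecture node -/

namespace RegMult

variable (W : WeierstrassCurve ℚ) [W.IsElliptic] [W.IsGloballyMinimal]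

/-- **REG3B, kernel side (the 961 split ∧ (ram) TRUE-OPEN X11b classes at `3`).** For an X11b pair at
`p = 3` (`ClassX11b W 3`: `r_an = 1`, `3 ‖ N`, `E[3]` irreducible), SPLIT at `3`, with a (ram) prime:
`BSD(E,3)` from the PUBLISHED named facts (Skinner 2016 Thm. A `hA`; Stein–Wuthrich 2013 Thm. 6.1 split
`hJs` + §4.2 height existence `hHs`; GZK `hGZK`; modularity `hpar`) and TWO per-pair inputs: ONE
REGMULT-PAIR/v1 row of the split kind, `CertSplit W 3 P m` (`m·P` admissible, modified §4.2 height of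
`m·P ≠ 0` for THE Tate datum — a register `cells/x11b3/PREDICTIONS-REG3B.md` 'CERT Reg₃ ≠ 0,
two-engine' row; EVIDENCE, instrumentation tier), AND the conjecture `RelativeExceptionalLeadingTermAt
W 3` (the residue's NAMED INPUT; not in print at `3`). The certificate discharges the (R4) regulator
input index-, generator- and saturation-free (`schneiderHalf_split_of_cert`, rank one by GZK); it books
NOTHING by itself (register §5: "ONE of TWO inputs"). CONDITIONAL; nothing booked; O2 OPEN; the 961
stay TRUE-OPEN. [cite: Skinner2016PacificMC, Thm. A] [cite: SteinWuthrich2013, Thm. 6.1, §4.2 (p. 16)]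
[cite: MazurTateTeitelbaum1986Invent, §II.10] [cite: Miller2011LMS, Def. 1.1] -/
theorem Three.bsdp_of_classX11b_of_split_of_ram_of_cert_of_relativeExceptional [Fact (Nat.Prime 3)]
    (hA : thmA_charIdeal_multiplicative) (hJs : thm61_splitMultiplicative)
    (hHs : exists_isSplitMultCanonical)
    (hGZK : rank_eq_analyticRank_of_analyticRank_le_one) (hpar : nonempty_modularParametrizationData)
    (hX : ClassX11b W 3) (hsplit : W.HasSplitMultiplicativeReductionAtPrime 3) (hram : Ram W 3)
    (hC : ClassClosure.RelativeExceptionalLeadingTermAt W 3)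
    {P : W.toAffine.Point} {m : ℕ} (hc : CertSplit W 3 P m) : BSDp W 3 :=
  ClassClosure.bsdp_three_of_splitThreeResidue_of_conjecture_of_schneiderSplit W hA hJs hHs hGZK hpar
    hX ⟨hsplit, hram⟩ hC
    (schneiderHalf_split_of_cert (mordellWeilRank_eq_one_of_analyticRank hGZK hX.1) hc)

/-- The same with the residue predicate bundled (`SplitThreeResidueAt W = split ∧ Ram W 3`).
[cite: Skinner2016PacificMC, Thm. A] [cite: SteinWuthrich2013, Thm. 6.1, §4.2 (p. 16)] -/
theorem Three.bsdp_of_classX11b_of_splitThreeResidue_of_cert_of_relativeExceptional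
    [Fact (Nat.Prime 3)]
    (hA : thmA_charIdeal_multiplicative) (hJs : thm61_splitMultiplicative)
    (hHs : exists_isSplitMultCanonical)
    (hGZK : rank_eq_analyticRank_of_analyticRank_le_one) (hpar : nonempty_modularParametrizationData)
    (hX : ClassX11b W 3) (hres : ClassClosure.SplitThreeResidueAt W)
    (hC : ClassClosure.RelativeExceptionalLeadingTermAt W 3)
    {P : W.toAffine.Point} {m : ℕ} (hc : CertSplit W 3 P m) : BSDp W 3 :=
  Three.bsdp_of_classX11b_of_split_of_ram_of_cert_of_relativeExceptional W hA hJs hHs hGZK hpar hX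
    hres.1 hres.2 hC hc

/-! ### §3 The whole (ram) atom of N8/O2 at `3`: ONE row of the pair's sign (+ the conjecture if split) -/

/-- **ONE VERDICT PER (ISOGENY CLASS, 3), kernel side.** For every X11b pair at `3` with a (ram) prime
— all 1 684 TRUE-OPEN X11b classes at `3` (x11b3 CLASS RECORD: 722 non-split ∧ Ram + 961 split ∧ Ram,
+ 318828a1 off the (ram) locus, not covered here) —: `BSD(E,3)` from the PUBLISHED named facts of
cc-typer-3's lever (Skinner 2016 Thm. A `hA`; Stein–Wuthrich 2013 Thm. 6.1 ×2 `hJn hJs` and §4.2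
height existence ×2 `hHn hHs`; Disegni 2020 Thm. 1 `hD` — used on the non-split side only, where it is
in print at every `p`; GZK; modularity), ONE REGMULT-PAIR/v1 row OF THE PAIR'S SIGN (`hcn` used iff
non-split — `RegMult.bsdp_of_ram_nonsplit_of_cert`, the lever locus; `hcs` iff split — §2), and, ONLY
if the pair is split at `3`, the conjecture `RelativeExceptionalLeadingTermAt W 3` (`hC3`). This is
cc-typer-3's statement of record `bsdp_of_ram_of_regulatorNonvanishing_of_conjectureAtThree` at `p = 3`
in certificate currency (the certificate replaces the bundled `RegulatorNonvanishingAt W 3`, by sign).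
CONDITIONAL; nothing booked; O2 OPEN; every class stays TRUE-OPEN until the lane / referee A rule on
what a certified row is worth AND (split side) the conjecture is a theorem.
[cite: Skinner2016PacificMC, Thm. A] [cite: SteinWuthrich2013, Thm. 6.1, §4.2]
[cite: Disegni2020, Thm. 1 (§1.2)] [cite: Miller2011LMS, Def. 1.1] -/
theorem Three.bsdp_of_classX11b_of_ram_of_cert_of_conjectureIfSplit [Fact (Nat.Prime 3)]
    (hA : thmA_charIdeal_multiplicative)
    (hJn : thm61_nonsplitMultiplicative) (hJs : thm61_splitMultiplicative)
    (hHn : exists_isMultCanonical) (hHs : exists_isSplitMultCanonical)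
    (hD : thm1_padicBSD_rankOne_multiplicative)
    (hGZK : rank_eq_analyticRank_of_analyticRank_le_one) (hpar : nonempty_modularParametrizationData)
    (hX : ClassX11b W 3) (hram : Ram W 3) {P : W.toAffine.Point} {m : ℕ}
    (hcn : ¬ W.HasSplitMultiplicativeReductionAtPrime 3 → CertNonsplit W 3 P m)
    (hcs : W.HasSplitMultiplicativeReductionAtPrime 3 → CertSplit W 3 P m)
    (hC3 : W.HasSplitMultiplicativeReductionAtPrime 3 → ClassClosure.RelativeExceptionalLeadingTermAt W 3) :
    BSDp W 3 := by
  by_cases hsplit : W.HasSplitMultiplicativeReductionAtPrime 3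
  · exact Three.bsdp_of_classX11b_of_split_of_ram_of_cert_of_relativeExceptional W hA hJs hHs hGZK hpar
      hX hsplit hram (hC3 hsplit) (hcs hsplit)
  · exact bsdp_of_ram_nonsplit_of_cert W 3 hA hJn hJs hHn hHs hD hGZK hpar hX hsplit hram (hcn hsplit)

/-! ### §4 Converse bookkeeping in certificate currency: the ORDER clause of X11b-1 (split) -/

/-- **What the residue's two inputs give back of the census relation (any odd `p`).** Granted the
conjecture `RelativeExceptionalLeadingTermAt W p` (`hC`, identity up to `u ∈ ℤ_pˣ`), ONE split REGMULT
row `CertSplit W p P m` (`hc`) and Greenberg–Stevens (`hGS`, `ord ≥ 2`): clause (i) of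
`CensusLeadingTermSplit W p` holds for the given data — `ord_{T=0} L_p(E,T) = 2` exactly (`#Ш_an ≠ 0`
by Gross–Zagier `hGZ`, `𝓛_p ≠ 0` by Barré-Sirieix–Diaz–Gramain–Philibert, `Reg_p ≠ 0` by the row via
`schneiderHalf_split_of_cert` in rank one). p250497's `order_eq_two_of_relativeExceptional_of_schneider`
with the certificate in place of `hSch`; the identity clause (ii) is NOT recovered (exactness `u = 1` is
the census's surplus). [cite: GreenbergStevens1993, Introduction (0.6)]
[cite: BarreSirieixDiazGramainPhilibert1996Manin, Thm. 1] [cite: GrossZagier1986, Thm. I.(7.3) 2)]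
[cite: SteinWuthrich2013, §4.2 (p. 16)] -/
theorem order_eq_two_of_relativeExceptional_of_cert (hGZ : GrossZagier1986_thm_I_7_3)
    (hGZK : rank_eq_analyticRank_of_analyticRank_le_one) (p : ℕ) [Fact p.Prime]
    (hGS : greenberg_stevens W p) (hC : ClassClosure.RelativeExceptionalLeadingTermAt W p)
    (hp : p ≠ 2) (Dq : TateParameterData W p) (hr : W.analyticRank = 1)
    {N : ℕ} [NeZero N] {f : CuspForm (Gamma0 N) 2} (hf : IsNewformOf W f)
    {L : PowerSeries ℚ_[p]} (hL : IsSplitMultPAdicLFunctionOf f p L)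
    {Dh : PAdicHeightData W p} (hDh : IsSplitMultCanonical Dh Dq)
    {ϖ : ℚ} (hϖ : (ϖ : ℝ) * W.realPeriodRat = plusPeriod f)
    {P : W.toAffine.Point} {m : ℕ} (hc : CertSplit W p P m) : L.order = 2 :=
  order_eq_two_of_relativeExceptional_of_schneider hGZ hGZK W p hGS hC hp Dq hr hf hL hDh hϖ
    (schneiderHalf_split_of_cert (mordellWeilRank_eq_one_of_analyticRank hGZK hr) hc Dq Dh hDh)

end RegMult

end Summit.BirchSwinnertonDyer.Rank1Residual.X11b
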